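import Summits.Parity.GeneralizedHardyLittlewood.Theses.LiouvilleMAD
import Summits.Parity.GeneralizedHardyLittlewood.Theorems.LiouvilleMADFanDecorrelationStubResidueSplitting
import Summits.Parity.GeneralizedHardyLittlewood.Theorems.LiouvilleMADFanDecorrelationStubFanFromLaws

/-!
# Crux `FanDecorrelation` (stmt-Parity-13318) — line `SketchIdeator1` (= idea `lag-window-normal-form`)

Skeleton owned by the line lead (prover-line-stmt-Parity-13318-0).  Composition idea (ideator 1,
`Cruxes/FanDecorrelation/SketchIdeator1.lean`, everything but the two laws kernel-proved there):

* RESIDUE SPLITTING `m = k y + r` (exact reindexing, stub 1): for `1 ≤ k ≤ M` the fan sum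
  `R_k = Σ_{j∈[Q,2Q)} Σ_{(m,m')∈(M,2M]², m−m'=kj} λ(mn+c)λ(m'n'+c)` (`Q = ⌊√M⌋+1`) equals
  `Σ_{r<k} U_r`, `U_r` = the UNIT FAN of class `r`: the window `y − y' ∈ [Q,2Q)` of the cross sum of
  the two row sequences `y ↦ λ((ky+r)n+c)`, `y' ↦ λ((ky'+r)n'+c)` on the box `((M−r)/k,(2M−r)/k]²`.
* LAG-WINDOW LAW at `δ = 1/8` (stub 2, OPEN, conjecture-grade, held by the lead): for
  `1 ≤ k ≤ M^{3/8}` every unit fan is `≤ C·M^{1−κ}/k` (some `κ > 0`).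
* FAN-WINDOW COSET LAW at `δ = 1/8` (stub 3, OPEN, conjecture-grade): for `M^{3/8} ≤ k < 2Q` the
  class-summed unit fans are `≤ C·M^{3/4+ϑ}` (some `ϑ < 1/4`) — by stub 1 this is the crux itself
  restricted to `k ≥ M^{3/8}`, in coset (class-summed) form.
* TRANSFER (stub 4, PROVABLE NOW, bookkeeping): stub 1 + the two laws at one `δ > 0` ⟹ the crux
  (`k ≤ M^{1/2−δ}`: sum the per-class bound over `r < k`; `M^{1/2−δ} < k < 2Q`: the coset law;
  `k ≥ 2Q`: the fan is empty; `k < 0`: swap `(m,m') ↦ (m',m)`, `(n,n') ↦ (n',n)`; `M < 8`: trivial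
  bound; `ϑ = max(ϑ₂, 1/4 − κ, 0)`).

`FanDecorrelation_of` concludes the route decl BY NAME from the four stubs; `sorry` occurs only in
`stub_*`.  All stub signatures are self-contained over Mathlib, so each lands verbatim as a
`--supports stmt-Parity-13318` file under `Theorems/`.

STATUS after wave 1 (2026-08-16): stubs 1 and 4 LANDED (p96332 `…Theorems.FanDecorrelation.
ResidueSplitting.stub_residueSplitting`, p96381 `…Theorems.FanDecorrelation.FanFromLaws.stub_fanFromLaws`,
both ACCEPTED, axioms {propext, Classical.choice, Quot.sound}) and are imported below; the two
remaining `sorry`s are the two conjecture-grade laws.  So the tree now contains, kernel-checked: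
lag-window law (δ) ∧ fan-window coset law (δ) ⟹ `FanDecorrelation`, for every `δ > 0`.
Remark (stub-worker, wave 1): the fan is already EMPTY for `k ≥ Q` (`kj ≥ Q² > M − 1 ≥ m − m'`), so
the live range of stub 3 is `q ∈ [M^{3/8}, Q)`; the registered bound `q < 2Q` is loose but harmless.
-/

namespace Summit.Parity.GeneralizedHardyLittlewood.Cruxes.FanDecorrelation.LagWindowNormalForm

open Summit.Parity.GeneralizedHardyLittlewood.Theses.LiouvilleMAD

/-! ### Registered stubs (self-contained signatures) -/

/-- Stub 1 (PROVABLE NOW, size M; `residueSplitting_holds` of `SketchIdeator1.lean` with the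
definitions `fanSum`/`windowSum`/`rowSeq` unfolded) — **residue splitting**: for `1 ≤ k ≤ M`,
`R_k = Σ_{r<k} Σ_{(y,y') ∈ ((M−r)/k,(2M−r)/k]², y−y' ∈ [Q,2Q)} λ((ky+r)n+c) λ((ky'+r)n'+c)`
(`m = ky + r`, `m' = ky' + r`; `m ∈ (M,2M] ↔ y ∈ ((M−r)/k,(2M−r)/k]` in `ℕ`-division since
`r < k ≤ M`; `m − m' = kj ↔ y − y' = j`; each pair is counted once, for its unique `j`). -/
theorem stub_residueSplitting :
    ∀ (c : ℤ) (n n' M k : ℕ), 1 ≤ k → k ≤ M →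
      (∑ j ∈ Finset.Ico (Nat.sqrt M + 1) (2 * (Nat.sqrt M + 1)),
          ∑ p ∈ (Finset.Ioc M (2 * M) ×ˢ Finset.Ioc M (2 * M)).filter
              (fun p : ℕ × ℕ => (p.1 : ℤ) - p.2 = (k : ℤ) * (j : ℤ)),
            (ArithmeticFunction.liouville (Int.toNat ((p.1 : ℤ) * n + c)) : ℝ) *
              (ArithmeticFunction.liouville (Int.toNat ((p.2 : ℤ) * n' + c)) : ℝ)) =
        ∑ r ∈ Finset.range k,
          ∑ p ∈ (Finset.Ioc ((M - r) / k) ((2 * M - r) / k) ×ˢ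
                  Finset.Ioc ((M - r) / k) ((2 * M - r) / k)).filter
              (fun p : ℕ × ℕ => (Nat.sqrt M : ℤ) + 1 ≤ (p.1 : ℤ) - p.2 ∧
                (p.1 : ℤ) - p.2 < 2 * ((Nat.sqrt M : ℤ) + 1)),
            (ArithmeticFunction.liouville (Int.toNat (((k : ℤ) * p.1 + r) * n + c)) : ℝ) *
              (ArithmeticFunction.liouville (Int.toNat (((k : ℤ) * p.2 + r) * n' + c)) : ℝ) :=
  -- landed (p96332): Summit.Parity.GeneralizedHardyLittlewood.Theorems.FanDecorrelation.ResidueSplitting.stub_residueSplitting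
  Summit.Parity.GeneralizedHardyLittlewood.Theorems.FanDecorrelation.ResidueSplitting.stub_residueSplitting

/-- Stub 2 (OPEN, conjecture-grade — the hardest stub, held by the lead) — **lag-window law at
`δ = 1/8`**: for every shift `c ≠ 0` there are `κ > 0` and `C` such that for all `M`, all
dilations `1 ≤ n ≠ n' ≤ 2M`, all `1 ≤ k ≤ M^{3/8}` and every class `r < k`, the unit fan
`U_r = Σ_{(y,y') ∈ ((M−r)/k,(2M−r)/k]², y−y' ∈ [Q,2Q)} λ((ky+r)n+c) λ((ky'+r)n'+c)` is
`≤ C·M^{1−κ}/k` in absolute value.  Random-model size of a unit fan is `(Q·M/k)^{1/2} = M^{3/4}k^{−1/2}`,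
below `M^{1−κ}/k` exactly when `k ≤ M^{1/2−2κ}` (so `κ ≤ 1/16` is forced here).  Its `k = 1`, `r = 0`
instance is the crux at `k = 1` verbatim: beyond GRH ("signed, power-saving, shift-averaged two-point
Chowla over a window of `√M` consecutive lags"); numerically Poisson (kit j015184, j015548). -/
theorem stub_lagWindowLaw :
    ∀ c : ℤ, c ≠ 0 → ∃ κ : ℝ, 0 < κ ∧ ∃ C : ℝ, ∀ M n n' k r : ℕ,
      1 ≤ n → 1 ≤ n' → n ≠ n' → n ≤ 2 * M → n' ≤ 2 * M → 1 ≤ k →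
        (k : ℝ) ≤ (M : ℝ) ^ (1 / 2 - 1 / 8 : ℝ) → r < k →
          |∑ p ∈ (Finset.Ioc ((M - r) / k) ((2 * M - r) / k) ×ˢ
                  Finset.Ioc ((M - r) / k) ((2 * M - r) / k)).filter
              (fun p : ℕ × ℕ => (Nat.sqrt M : ℤ) + 1 ≤ (p.1 : ℤ) - p.2 ∧
                (p.1 : ℤ) - p.2 < 2 * ((Nat.sqrt M : ℤ) + 1)),
            (ArithmeticFunction.liouville (Int.toNat (((k : ℤ) * p.1 + r) * n + c)) : ℝ) *
              (ArithmeticFunction.liouville (Int.toNat (((k : ℤ) * p.2 + r) * n' + c)) : ℝ)| ≤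
            C * (M : ℝ) ^ (1 - κ) / k := by
  sorry

/-- Stub 3 (OPEN, conjecture-grade) — **fan-window coset law at `δ = 1/8`**: for every shift
`c ≠ 0` there are `ϑ < 1/4` and `C` such that for all `M`, all dilations `1 ≤ n ≠ n' ≤ 2M` and all
moduli `M^{3/8} ≤ q < 2Q`, the class-SUMMED unit fans
`Σ_{r<q} Σ_{(y,y') ∈ ((M−r)/q,(2M−r)/q]², y−y' ∈ [Q,2Q)} λ((qy+r)n+c) λ((qy'+r)n'+c)` are
`≤ C·M^{3/4+ϑ}`.  By stub 1 this is the crux restricted to `k = q ≥ M^{3/8}` (random size `M^{3/4}`;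
in this regime per-class bounds cannot work — `√q·M^{3/4}q^{−1/2}`-type losses reach `M` — so the
content is sign cancellation ACROSS the `q` classes: the COSET mechanism of the sibling crux
`CosetDecorrelation`, stmt-Parity-13317, at moduli `[M^{3/8}, 2√M)` with the Toeplitz lag window
`[Q,2Q)`).  Beyond GRH; numerically random-model (kit j015184, j015613). -/
theorem stub_fanWindowCosetLaw :
    ∀ c : ℤ, c ≠ 0 → ∃ ϑ : ℝ, ϑ < 1 / 4 ∧ ∃ C : ℝ, ∀ M n n' q : ℕ,
      1 ≤ n → 1 ≤ n' → n ≠ n' → n ≤ 2 * M → n' ≤ 2 * M →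
        (M : ℝ) ^ (1 / 2 - 1 / 8 : ℝ) ≤ q → q < 2 * (Nat.sqrt M + 1) →
          |∑ r ∈ Finset.range q,
              ∑ p ∈ (Finset.Ioc ((M - r) / q) ((2 * M - r) / q) ×ˢ
                      Finset.Ioc ((M - r) / q) ((2 * M - r) / q)).filter
                  (fun p : ℕ × ℕ => (Nat.sqrt M : ℤ) + 1 ≤ (p.1 : ℤ) - p.2 ∧
                    (p.1 : ℤ) - p.2 < 2 * ((Nat.sqrt M : ℤ) + 1)),
                (ArithmeticFunction.liouville (Int.toNat (((q : ℤ) * p.1 + r) * n + c)) : ℝ) *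
                  (ArithmeticFunction.liouville (Int.toNat (((q : ℤ) * p.2 + r) * n' + c)) : ℝ)| ≤
            C * (M : ℝ) ^ (3 / 4 + ϑ) := by
  sorry

/-- Stub 4 (PROVABLE NOW, size M; `fanFromLaws_holds` of `SketchIdeator1.lean` unfolded, with
`fanSumNeg_holds`, `fanEmptyLargeK_holds`, `abs_fanSum_le`, `const_rpow_le` as internal lemmas) —
**the transfer**: residue splitting (stub 1 verbatim, as a hypothesis) and the two laws at ONE
`δ > 0` (stubs 2 and 3 with `1/8 ↦ δ`, as hypotheses) imply the crux — stated here as the BODY of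
the route decl `FanDecorrelation` verbatim, so that only `FanDecorrelation_of` mentions the crux by
name (`FanDecorrelation_of` is this stub applied, by `δ`-unfolding of the route decl).
Bookkeeping only: `ϑ = max(ϑ₂, 1/4 − κ, 0)`, `C = max(C₁, C₂, 512)`; `1 ≤ k ≤ M^{1/2−δ}` by summing
the per-class bound over `r < k`; `M^{1/2−δ} < k < 2Q` by the coset law with `q = k`; `k ≥ 2Q`: the
fan is EMPTY (`kj ≥ 2Q² > 2M > m − m'`); `k < 0`: `R_{−k}(n,n') = R_k(n',n)` (swap the pair);
`M < 8`: `|R_k| ≤ (⌊√M⌋+1)M² ≤ 147`. -/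
theorem stub_fanFromLaws :
    (∀ (c : ℤ) (n n' M k : ℕ), 1 ≤ k → k ≤ M →
      (∑ j ∈ Finset.Ico (Nat.sqrt M + 1) (2 * (Nat.sqrt M + 1)),
          ∑ p ∈ (Finset.Ioc M (2 * M) ×ˢ Finset.Ioc M (2 * M)).filter
              (fun p : ℕ × ℕ => (p.1 : ℤ) - p.2 = (k : ℤ) * (j : ℤ)),
            (ArithmeticFunction.liouville (Int.toNat ((p.1 : ℤ) * n + c)) : ℝ) *
              (ArithmeticFunction.liouville (Int.toNat ((p.2 : ℤ) * n' + c)) : ℝ)) =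
        ∑ r ∈ Finset.range k,
          ∑ p ∈ (Finset.Ioc ((M - r) / k) ((2 * M - r) / k) ×ˢ
                  Finset.Ioc ((M - r) / k) ((2 * M - r) / k)).filter
              (fun p : ℕ × ℕ => (Nat.sqrt M : ℤ) + 1 ≤ (p.1 : ℤ) - p.2 ∧
                (p.1 : ℤ) - p.2 < 2 * ((Nat.sqrt M : ℤ) + 1)),
            (ArithmeticFunction.liouville (Int.toNat (((k : ℤ) * p.1 + r) * n + c)) : ℝ) *
              (ArithmeticFunction.liouville (Int.toNat (((k : ℤ) * p.2 + r) * n' + c)) : ℝ)) →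
    ∀ δ : ℝ, 0 < δ →
    (∀ c : ℤ, c ≠ 0 → ∃ κ : ℝ, 0 < κ ∧ ∃ C : ℝ, ∀ M n n' k r : ℕ,
      1 ≤ n → 1 ≤ n' → n ≠ n' → n ≤ 2 * M → n' ≤ 2 * M → 1 ≤ k →
        (k : ℝ) ≤ (M : ℝ) ^ (1 / 2 - δ) → r < k →
          |∑ p ∈ (Finset.Ioc ((M - r) / k) ((2 * M - r) / k) ×ˢ
                  Finset.Ioc ((M - r) / k) ((2 * M - r) / k)).filter
              (fun p : ℕ × ℕ => (Nat.sqrt M : ℤ) + 1 ≤ (p.1 : ℤ) - p.2 ∧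
                (p.1 : ℤ) - p.2 < 2 * ((Nat.sqrt M : ℤ) + 1)),
            (ArithmeticFunction.liouville (Int.toNat (((k : ℤ) * p.1 + r) * n + c)) : ℝ) *
              (ArithmeticFunction.liouville (Int.toNat (((k : ℤ) * p.2 + r) * n' + c)) : ℝ)| ≤
            C * (M : ℝ) ^ (1 - κ) / k) →
    (∀ c : ℤ, c ≠ 0 → ∃ ϑ : ℝ, ϑ < 1 / 4 ∧ ∃ C : ℝ, ∀ M n n' q : ℕ,
      1 ≤ n → 1 ≤ n' → n ≠ n' → n ≤ 2 * M → n' ≤ 2 * M →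
        (M : ℝ) ^ (1 / 2 - δ) ≤ q → q < 2 * (Nat.sqrt M + 1) →
          |∑ r ∈ Finset.range q,
              ∑ p ∈ (Finset.Ioc ((M - r) / q) ((2 * M - r) / q) ×ˢ
                      Finset.Ioc ((M - r) / q) ((2 * M - r) / q)).filter
                  (fun p : ℕ × ℕ => (Nat.sqrt M : ℤ) + 1 ≤ (p.1 : ℤ) - p.2 ∧
                    (p.1 : ℤ) - p.2 < 2 * ((Nat.sqrt M : ℤ) + 1)),
                (ArithmeticFunction.liouville (Int.toNat (((q : ℤ) * p.1 + r) * n + c)) : ℝ) *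
                  (ArithmeticFunction.liouville (Int.toNat (((q : ℤ) * p.2 + r) * n' + c)) : ℝ)| ≤
            C * (M : ℝ) ^ (3 / 4 + ϑ)) →
    ∀ c : ℤ, c ≠ 0 → ∃ ϑ : ℝ, ϑ < 1 / 4 ∧ ∃ C : ℝ, ∀ M n n' : ℕ, ∀ k : ℤ,
      1 ≤ n → 1 ≤ n' → n ≠ n' → n ≤ 2 * M → n' ≤ 2 * M → k ≠ 0 →
        |∑ j ∈ Finset.Ico (Nat.sqrt M + 1) (2 * (Nat.sqrt M + 1)),
            ∑ p ∈ (Finset.Ioc M (2 * M) ×ˢ Finset.Ioc M (2 * M)).filter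
                (fun p : ℕ × ℕ => (p.1 : ℤ) - p.2 = k * (j : ℤ)),
              (ArithmeticFunction.liouville (Int.toNat ((p.1 : ℤ) * n + c)) : ℝ) *
                (ArithmeticFunction.liouville (Int.toNat ((p.2 : ℤ) * n' + c)) : ℝ)| ≤
          C * (M : ℝ) ^ (3 / 4 + ϑ) :=
  -- landed (p96381): Summit.Parity.GeneralizedHardyLittlewood.Theorems.FanDecorrelation.FanFromLaws.stub_fanFromLaws
  Summit.Parity.GeneralizedHardyLittlewood.Theorems.FanDecorrelation.FanFromLaws.stub_fanFromLaws

/-! ### Composition -/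

/-- **The line concludes the crux BY NAME.**  The route decl
`Summit.Parity.GeneralizedHardyLittlewood.Theses.LiouvilleMAD.FanDecorrelation` from the four
registered stubs: the transfer (stub 4) applied to residue splitting (stub 1) and the two laws at
`δ = 1/8` (stubs 2, 3).  `sorry` occurs only inside the stubs. -/
theorem FanDecorrelation_of :
    Summit.Parity.GeneralizedHardyLittlewood.Theses.LiouvilleMAD.FanDecorrelation :=
  stub_fanFromLaws stub_residueSplitting (1 / 8) (by norm_num) stub_lagWindowLaw
    stub_fanWindowCosetLaw

end Summit.Parity.GeneralizedHardyLittlewood.Cruxes.FanDecorrelation.LagWindowNormalForm
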